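import Mathlib.Analysis.SpecificLimits.Basic
import Literature.Analysis.FunctionSpaces.TorusCalculus
import HarnessLib

/-!
# Two-scale (monophase BKW) profiles on the flat torus `T^d × T¹`

The vocabulary of large-amplitude MONOPHASE nonlinear geometric optics ("méthode BKW", two-scale / WKB
calculus) on the flat torus, route-independent and in every dimension `d`:

* a PROFILE is a function `Φ : T^{d+1} → F` of a two-scale point `y = (x, θ)`, slow point `x = slow y ∈ T^d`
  (the first `d` coordinates) and fast variable `θ = fast y ∈ T¹ = ℝ/ℤ` (the last one); its `θ`-mean
  `thetaMean Φ` and oscillating part `oscPart Φ = Φ − ⟨Φ⟩` [cite: CheverryGuesMetivier2003, §2.2 p. 695];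
* a PHASE on the torus is a smooth circle-valued `S : T^d → T¹`; every such map is `S(x) = j·x + G(x)` with an
  integer frequency vector `j : Fin d → ℤ` (its degree) and a periodic `G : T^d → ℝ`, so `(j, G)` is the general
  monophase datum; `θ = S/ε ∈ ℝ/ℤ` is well defined exactly when `ε⁻¹ ∈ ℤ`, whence the discrete scale
  `ε_n = 1/(n+1)` (`epsN`), the fast phase `fastPhase j G n = (n+1)S mod 1`, the EVALUATION MAP
  `phaseMap j G n : x ↦ (x, (n+1)S(x))` (the substitution `θ = φ/ε` of [cite: CheverryGuesMetivier2003, §2.3 p. 697])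
  and the phase gradient `k = ∇S = ∇G + j` (`phaseGrad`);
* the TWO-SCALE DERIVATIVE `D^ε_i = ∂_{xᵢ} + ε⁻¹ kᵢ(x) ∂_θ` (`tsDeriv`): the rule `∂ᵢ ↦ ∂ᵢ + ε⁻¹ ∂ᵢφ ∂_θ` by which
  the singular system `(S)` of [cite: CheverryGuesMetivier2003, §2.3 p. 697] (resp. `d_{j,ε} = ε∂ⱼ + ∂ⱼφ ∂_θ`,
  `grad^ε`, `div^ε` of [cite: Cheverry2006, §4.1 eq. (4.4)]) is obtained from the original one, together with the
  derived two-scale divergence, convective derivative, Laplacian `∑ᵢ (D^ε_i)²`, gradient, and the steady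
  incompressible Navier–Stokes residual at the critical viscosity `ε²` in a frame drifting along one axis
  (`tsDiv`, `tsConvect`, `tsLaplacian`, `tsGrad`, `tsResidual`; cf. the singular incompressible system
  [cite: Cheverry2006, §4.2 eq. (4.10)]), the viscosity `nuN = epsN²` and the fast dissipation density
  `|k|²‖∂_θΦ‖²` (`dissDensity`);
* the `ε`-FREE calculus of the polynomial ansatz `∑_a ε^a Φ_a`: slow derivative `sDeriv i = ∂_{xᵢ}`, weighted fast
  derivative `fDeriv j G i = kᵢ ∂_θ` (`tsDeriv = sDeriv + ε⁻¹ • fDeriv`, `tsDeriv_eq_sDeriv_add_smul_fDeriv`), and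
  the coefficient profiles `divCoeff`, `hierarchyCoeff` of `ε^s` in `ε · tsDiv` and `ε · tsResidual` of the
  ansatz — the steady analogue of the profile equations "arranged according to the different powers of `ε`"
  of [cite: Cheverry2006, §4.2 eq. (4.13)];
* §7: the real lift `phaseLift` of the evaluation map, smoothness of evaluated profiles and the FIRST-ORDER CHAIN
  RULE `∂ᵢ (Φ ∘ e_n) = (D^{ε_n}_i Φ) ∘ e_n` (`partialDeriv_comp_phaseMap`) — the content of the remark "toute
  solution `u^ε(t,x,θ)` du système (S) fournit une solution `u^ε(t,x,φ^ε/ε)`" [cite: CheverryGuesMetivier2003,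
  §2.3 p. 697].

Locators for `Cheverry2006` (Bull. SMF 134 (2006) 33–82) are the section/equation numbers of the held HAL version
hal-00001175 (= arXiv:math/0402408): §4.1 "Interpretation in (t, x, θ)" p. 24, §4.2 pp. 25–27.

Design.  Everything is stated for the tree's representative-free torus calculus
(`Literature.Analysis.FunctionSpaces.Torus.partialDeriv`, `IsSmooth`, `lift`, `proj`); the fast circle is the LAST
coordinate of `T^{d+1}` (`Fin.last d`), slow coordinates are `Fin.castSucc i`.  The summit-side vocabulary of
`Summit.AnomalousDissipation.….Theorems.TaylorWaveQuasiSteady` (`d = 3`, drift axis `2`) is, definition by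
definition, the specialisation of this file (same bodies), so it can be turned into abbreviations of it.
NOT here: time-dependent profiles and slow time, multiphase expansions, the formal expansion identities
`ε · tsDiv (∑ ε^a P_a) = ∑ ε^s divCoeff s` (pure algebra, proved summit-side), Sobolev spaces of profiles.
-/

noncomputable section

open scoped BigOperators Topology ContDiff
open Filter MeasureTheory

namespace Literature.Analysis.GeometricOptics

open Literature.Analysis.FunctionSpaces Literature.Analysis.FunctionSpaces.Torus

namespace TwoScale

variable {d : ℕ}
variable {F : Type*} [NormedAddCommGroup F] [NormedSpace ℝ F]

/-! ## §1 Scales -/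

/-- The small parameter at level `n`, `ε_n = 1/(n+1)`: on the torus a circle-valued phase can only be divided by
the reciprocal of an integer, whence the discrete family `ε⁻¹ = n + 1`. [folklore] -/
def epsN (n : ℕ) : ℝ := 1 / ((n : ℝ) + 1)

/-- The critical (strong-oscillation) viscosity at level `n`, `ν_n = ε_n²`: the scaling under which `ν Δ` is of
order one on profiles evaluated at `S/ε`. [folklore] -/
def nuN (n : ℕ) : ℝ := epsN n ^ 2

/-- `ε_n > 0`. [folklore] -/
theorem epsN_pos (n : ℕ) : 0 < epsN n := by
  unfold epsN
  positivity

/-- `ε_n⁻¹ = n + 1`. [folklore] -/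
theorem inv_epsN (n : ℕ) : (epsN n)⁻¹ = (n : ℝ) + 1 := by
  rw [epsN, one_div, inv_inv]

/-- `ε_n ≤ 1`. [folklore] -/
theorem epsN_le_one (n : ℕ) : epsN n ≤ 1 := by
  unfold epsN
  rw [div_le_one (by positivity)]
  linarith [n.cast_nonneg (α := ℝ)]

/-- `ν_n > 0`. [folklore] -/
theorem nuN_pos (n : ℕ) : 0 < nuN n :=
  pow_pos (epsN_pos n) 2

/-- `√ν_n = ε_n`. [folklore] -/
theorem sqrt_nuN (n : ℕ) : Real.sqrt (nuN n) = epsN n :=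
  Real.sqrt_sq (epsN_pos n).le

/-- `ε_n → 0`. [folklore] -/
theorem tendsto_epsN : Tendsto epsN atTop (𝓝 0) :=
  tendsto_one_div_add_atTop_nhds_zero_nat (𝕜 := ℝ)

/-- `ν_n → 0`. [folklore] -/
theorem tendsto_nuN : Tendsto nuN atTop (𝓝 0) := by
  have h := tendsto_epsN.pow 2
  rw [zero_pow two_ne_zero] at h
  exact h

/-! ## §2 Two-scale points: slow point, fast variable, `θ`-mean and oscillation -/

/-- The SLOW point `x ∈ T^d` of a two-scale point `y = (x, θ) ∈ T^{d+1}`: forget the fast variable (the last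
coordinate) — the "variables lentes" of Cheverry–Guès–Métivier 2003, §2.2. [folklore] -/
def slow (y : UnitAddTorus (Fin (d + 1))) : UnitAddTorus (Fin d) := fun i => y i.castSucc

/-- The FAST variable `θ ∈ T¹ = ℝ/ℤ` of a two-scale point `y = (x, θ)`: the last coordinate — the "variable rapide"
of Cheverry–Guès–Métivier 2003, §2.2 (who use `ℝ/2πℤ`). [folklore] -/
def fast (y : UnitAddTorus (Fin (d + 1))) : UnitAddCircle := y (Fin.last d)

/-- The `θ`-MEAN `⟨Φ⟩(x) = ∫_{T¹} Φ(x, θ) dθ` of a profile (the source's `ū = (2π)⁻¹ ∫ u dθ`; here `T¹ = ℝ/ℤ` has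
mass one). Junk value `0` for non-integrable slices. [cite: CheverryGuesMetivier2003, §2.2 p. 695] -/
def thetaMean (Φ : UnitAddTorus (Fin (d + 1)) → F) (x : UnitAddTorus (Fin d)) : F :=
  ∫ θ : UnitAddCircle, Φ (@Fin.snoc d (fun _ => UnitAddCircle) x θ)

/-- The OSCILLATING part `Φ* = Φ − ⟨Φ⟩` of a profile (`u* = u − ū`). [cite: CheverryGuesMetivier2003, §2.2 p. 695] -/
def oscPart (Φ : UnitAddTorus (Fin (d + 1)) → F) (y : UnitAddTorus (Fin (d + 1))) : F :=
  Φ y - thetaMean Φ (slow y)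

omit [NormedAddCommGroup F] [NormedSpace ℝ F] in
/-- `slow (x, θ) = x`. [folklore] -/
@[simp]
theorem slow_snoc (x : UnitAddTorus (Fin d)) (θ : UnitAddCircle) :
    slow (@Fin.snoc d (fun _ => UnitAddCircle) x θ) = x := by
  funext i
  simp [slow, Fin.snoc_castSucc]

omit [NormedAddCommGroup F] [NormedSpace ℝ F] in
/-- `fast (x, θ) = θ`. [folklore] -/
@[simp]
theorem fast_snoc (x : UnitAddTorus (Fin d)) (θ : UnitAddCircle) :
    fast (@Fin.snoc d (fun _ => UnitAddCircle) x θ) = θ := by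
  simp [fast, Fin.snoc_last]

omit [NormedAddCommGroup F] [NormedSpace ℝ F] in
/-- `(slow y, fast y) = y`. [folklore] -/
theorem snoc_slow_fast (y : UnitAddTorus (Fin (d + 1))) :
    @Fin.snoc d (fun _ => UnitAddCircle) (slow y) (fast y) = y :=
  Fin.snoc_init_self y

/-- The `θ`-mean of a profile depending on the slow point only is that function. [folklore] -/
theorem thetaMean_comp_slow [CompleteSpace F] (g : UnitAddTorus (Fin d) → F) (x : UnitAddTorus (Fin d)) :
    thetaMean (fun y => g (slow y)) x = g x := by
  simp only [thetaMean, slow_snoc]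
  rw [integral_const, probReal_univ, one_smul]

/-- A profile depending on the slow point only has no oscillating part. [folklore] -/
theorem oscPart_comp_slow [CompleteSpace F] (g : UnitAddTorus (Fin d) → F) (y : UnitAddTorus (Fin (d + 1))) :
    oscPart (fun y => g (slow y)) y = 0 := by
  simp [oscPart, thetaMean_comp_slow]

/-- `Φ = ⟨Φ⟩ ∘ slow + Φ*`. [folklore] -/
theorem thetaMean_add_oscPart (Φ : UnitAddTorus (Fin (d + 1)) → F) (y : UnitAddTorus (Fin (d + 1))) :
    thetaMean Φ (slow y) + oscPart Φ y = Φ y := by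
  simp [oscPart]

/-! ## §3 Monophase data on the torus: fast phase, evaluation map, phase gradient -/

/-- The FAST PHASE at level `n` of the phase `S = j·x + G(x)`: `θ_n(x) = ∑ᵢ ((n+1) jᵢ) • xᵢ + ↑((n+1) G x) ∈ ℝ/ℤ`
(`= (n+1) S(x) mod 1 = S/ε_n`), well defined on `T^d` because `(n+1) jᵢ ∈ ℤ`. [folklore] -/
def fastPhase (j : Fin d → ℤ) (G : UnitAddTorus (Fin d) → ℝ) (n : ℕ) (x : UnitAddTorus (Fin d)) : UnitAddCircle :=
  (∑ i : Fin d, (((n : ℤ) + 1) * j i) • x i) + ((((n : ℝ) + 1) * G x : ℝ) : UnitAddCircle)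

/-- The two-scale EVALUATION MAP `e_n : T^d → T^{d+1}`, `x ↦ (x, θ_n x)`: `Φ ∘ e_n` is the substitution
`θ = φ/ε` in the profile `Φ`. [cite: CheverryGuesMetivier2003, §2.3 p. 697] -/
def phaseMap (j : Fin d → ℤ) (G : UnitAddTorus (Fin d) → ℝ) (n : ℕ) (x : UnitAddTorus (Fin d)) :
    UnitAddTorus (Fin (d + 1)) :=
  @Fin.snoc d (fun _ => UnitAddCircle) x (fastPhase j G n x)

/-- Components of the PHASE GRADIENT `k = ∇S = ∇G + j` (the coefficients `∂ⱼφ` of `(S)`).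
[cite: CheverryGuesMetivier2003, §2.3 p. 697] -/
def phaseGrad (j : Fin d → ℤ) (G : UnitAddTorus (Fin d) → ℝ) (i : Fin d) (x : UnitAddTorus (Fin d)) : ℝ :=
  Torus.partialDeriv i G x + (j i : ℝ)

omit [NormedAddCommGroup F] [NormedSpace ℝ F] in
/-- `slow (e_n x) = x`. [folklore] -/
@[simp]
theorem slow_phaseMap (j : Fin d → ℤ) (G : UnitAddTorus (Fin d) → ℝ) (n : ℕ) (x : UnitAddTorus (Fin d)) :
    slow (phaseMap j G n x) = x :=
  slow_snoc x _

omit [NormedAddCommGroup F] [NormedSpace ℝ F] in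
/-- `fast (e_n x) = θ_n x`. [folklore] -/
@[simp]
theorem fast_phaseMap (j : Fin d → ℤ) (G : UnitAddTorus (Fin d) → ℝ) (n : ℕ) (x : UnitAddTorus (Fin d)) :
    fast (phaseMap j G n x) = fastPhase j G n x :=
  fast_snoc x _

/-- The phase gradient is smooth for smooth `G`. [folklore] -/
theorem isSmooth_phaseGrad (j : Fin d → ℤ) {G : UnitAddTorus (Fin d) → ℝ} (hG : IsSmooth G) (i : Fin d) :
    IsSmooth (phaseGrad j G i) :=
  (hG.partialDeriv i).add (isSmooth_const _)

/-! ## §4 Two-scale differential operators -/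

/-- The TWO-SCALE partial derivative in the slow direction `i` at scale `ε`:
`D^ε_i Φ (x, θ) = ∂_{xᵢ} Φ + ε⁻¹ kᵢ(x) ∂_θ Φ` — the substitution `∂ᵢ ↦ ∂ᵢ + ε⁻¹ ∂ᵢφ ∂_θ` producing the singular
system `(S)`. [cite: CheverryGuesMetivier2003, §2.3 p. 697] -/
def tsDeriv (ε : ℝ) (j : Fin d → ℤ) (G : UnitAddTorus (Fin d) → ℝ) (i : Fin d)
    (Φ : UnitAddTorus (Fin (d + 1)) → F) (y : UnitAddTorus (Fin (d + 1))) : F :=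
  Torus.partialDeriv i.castSucc Φ y +
    (ε⁻¹ * phaseGrad j G i (slow y)) • Torus.partialDeriv (Fin.last d) Φ y

/-- Two-scale DIVERGENCE `∑ᵢ D^ε_i Pᵢ` of a vector profile (`ε⁻¹ div^ε`, `div^ε = ε div + X·∂_θ`).
[cite: Cheverry2006, §4.1 eq. (4.4)] -/
def tsDiv (ε : ℝ) (j : Fin d → ℤ) (G : UnitAddTorus (Fin d) → ℝ)
    (P : UnitAddTorus (Fin (d + 1)) → EuclideanSpace ℝ (Fin d)) (y : UnitAddTorus (Fin (d + 1))) : ℝ :=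
  ∑ i : Fin d, (tsDeriv ε j G i P y) i

/-- Two-scale CONVECTIVE derivative `(P · D^ε) Φ = ∑ₗ Pₗ D^ε_l Φ` (`ε⁻¹ (ũ · grad^ε)`).
[cite: Cheverry2006, §4.1 eq. (4.4)] -/
def tsConvect (ε : ℝ) (j : Fin d → ℤ) (G : UnitAddTorus (Fin d) → ℝ)
    (P : UnitAddTorus (Fin (d + 1)) → EuclideanSpace ℝ (Fin d)) (Φ : UnitAddTorus (Fin (d + 1)) → F)
    (y : UnitAddTorus (Fin (d + 1))) : F :=
  ∑ l : Fin d, (P y) l • tsDeriv ε j G l Φ y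

/-- Two-scale LAPLACIAN `∑ᵢ D^ε_i D^ε_i Φ` (`= ε⁻²|k|²∂_θ² + 2ε⁻¹ k·∇∂_θ + ε⁻¹(div k)∂_θ + Δ_x` on smooth
profiles): the conjugate of `Δ_x` by evaluation on the fast phase. [folklore] -/
def tsLaplacian (ε : ℝ) (j : Fin d → ℤ) (G : UnitAddTorus (Fin d) → ℝ)
    (Φ : UnitAddTorus (Fin (d + 1)) → F) (y : UnitAddTorus (Fin (d + 1))) : F :=
  ∑ i : Fin d, tsDeriv ε j G i (tsDeriv ε j G i Φ) y

/-- Two-scale GRADIENT `(D^ε_i Q)ᵢ` of a scalar profile (`ε⁻¹ grad^ε`, `grad^ε = ε∇ + X ∂_θ`).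
[cite: Cheverry2006, §4.1 eq. (4.4)] -/
def tsGrad (ε : ℝ) (j : Fin d → ℤ) (G : UnitAddTorus (Fin d) → ℝ) (Q : UnitAddTorus (Fin (d + 1)) → ℝ)
    (y : UnitAddTorus (Fin (d + 1))) : EuclideanSpace ℝ (Fin d) :=
  WithLp.toLp 2 fun i : Fin d => tsDeriv ε j G i Q y

/-- The STEADY two-scale incompressible Navier–Stokes RESIDUAL at the critical viscosity `ε²`, in a frame
drifting with speed `c` along the axis `ic`, with a slow force `f`:
`(P·D^ε)P − ε² ∑ᵢ(D^ε_i)²P + D^εQ − c D^ε_{ic} P − f ∘ slow` — the profile form of `u·∇u − ε²Δu + ∇q − c∂_{ic}u − f`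
(cf. the singular incompressible system of the source, which carries `∂ₜ`, an adapted force and a model
viscosity instead). [folklore] -/
def tsResidual (ε : ℝ) (j : Fin d → ℤ) (G : UnitAddTorus (Fin d) → ℝ) (ic : Fin d)
    (f : UnitAddTorus (Fin d) → EuclideanSpace ℝ (Fin d)) (P : UnitAddTorus (Fin (d + 1)) → EuclideanSpace ℝ (Fin d))
    (Q : UnitAddTorus (Fin (d + 1)) → ℝ) (c : ℝ) (y : UnitAddTorus (Fin (d + 1))) : EuclideanSpace ℝ (Fin d) :=
  tsConvect ε j G P P y - ε ^ 2 • tsLaplacian ε j G P y + tsGrad ε j G Q y - c • tsDeriv ε j G ic P y - f (slow y)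

/-- The fast-phase DISSIPATION DENSITY `|k(x)|² ‖∂_θ Φ(x,θ)‖²` of a profile: the order-one part of
`ε² ∑ᵢ ‖D^ε_i Φ‖²`. [folklore] -/
def dissDensity (j : Fin d → ℤ) (G : UnitAddTorus (Fin d) → ℝ) (Φ : UnitAddTorus (Fin (d + 1)) → F)
    (y : UnitAddTorus (Fin (d + 1))) : ℝ :=
  ∑ i : Fin d, phaseGrad j G i (slow y) ^ 2 * ‖Torus.partialDeriv (Fin.last d) Φ y‖ ^ 2

/-! ## §5 The `ε`-free calculus of the polynomial ansatz -/

/-- The SLOW partial derivative `∂_{xᵢ} Φ` (`i : Fin d`) of a profile on `T^{d+1}`. [folklore] -/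
def sDeriv (i : Fin d) (Φ : UnitAddTorus (Fin (d + 1)) → F) (y : UnitAddTorus (Fin (d + 1))) : F :=
  Torus.partialDeriv i.castSucc Φ y

/-- The WEIGHTED FAST derivative `kᵢ(x) ∂_θ Φ` of a profile, `k = ∇G + j`; `ε⁻¹ • fDeriv` is the singular part of
`tsDeriv`. [folklore] -/
def fDeriv (j : Fin d → ℤ) (G : UnitAddTorus (Fin d) → ℝ) (i : Fin d) (Φ : UnitAddTorus (Fin (d + 1)) → F)
    (y : UnitAddTorus (Fin (d + 1))) : F :=
  phaseGrad j G i (slow y) • Torus.partialDeriv (Fin.last d) Φ y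

/-- **Formal two-scale divergence, coefficient of `ε^s`** in `ε · tsDiv ε j G (∑_{a<N+1} ε^a P_a)`:
`d_s = ∑_{a<N+1} ([a+1 = s] ∑ᵢ (∂_{xᵢ} P_a)ᵢ + [a = s] ∑ᵢ (kᵢ ∂_θ P_a)ᵢ)`, i.e. `d_0 = k·∂_θP_0`,
`d_s = div_x P_{s-1} + k·∂_θP_s` (cf. the incompressibility hierarchy `div U_j + ∂_θ V_{j+l} = 0` of Cheverry 2006,
§4.2 (4.13)). [folklore] -/
def divCoeff (j : Fin d → ℤ) (G : UnitAddTorus (Fin d) → ℝ) (N : ℕ)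
    (P : ℕ → UnitAddTorus (Fin (d + 1)) → EuclideanSpace ℝ (Fin d)) (s : ℕ) (y : UnitAddTorus (Fin (d + 1))) : ℝ :=
  ∑ a ∈ Finset.range (N + 1),
    ((if a + 1 = s then ∑ i : Fin d, (sDeriv i (P a) y) i else 0) +
      (if a = s then ∑ i : Fin d, (fDeriv j G i (P a) y) i else 0))

/-- **Formal steady two-scale residual, coefficient of `ε^s`** in
`ε · tsResidual ε j G ic f (∑_{a<N+1} ε^a P_a) (∑_{a<N+1} ε^a Q_a) (∑_{a<N+1} ε^a c_a)`, term by term as in `tsResidual`: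
convection `∑_{a,b} ([a+b+1 = s] ∑ₗ (P_a)ₗ ∂_{xₗ}P_b + [a+b = s] ∑ₗ (P_a)ₗ kₗ∂_θP_b)`; minus viscosity
`∑_a ([a+3 = s] ∑ᵢ ∂ᵢ∂ᵢP_a + [a+2 = s] ∑ᵢ (∂ᵢ(kᵢ∂_θP_a) + kᵢ∂_θ∂ᵢP_a) + [a+1 = s] ∑ᵢ kᵢ∂_θ(kᵢ∂_θP_a))`; plus pressure
`∑_a ([a+1 = s] ∇_xQ_a + [a = s] k∂_θQ_a)`; minus drift `∑_{a,b} ([a+b+1 = s] c_a ∂_{x_ic}P_b + [a+b = s] c_a k_{ic}∂_θP_b)`;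
minus force `[s = 1] f(x)` — the STEADY, drifting-frame, critical-viscosity analogue of the profile equations
"arranged according to the different powers of `ε`" of Cheverry 2006, §4.2 (4.13). [folklore] -/
def hierarchyCoeff (j : Fin d → ℤ) (G : UnitAddTorus (Fin d) → ℝ) (ic : Fin d)
    (f : UnitAddTorus (Fin d) → EuclideanSpace ℝ (Fin d)) (N : ℕ)
    (P : ℕ → UnitAddTorus (Fin (d + 1)) → EuclideanSpace ℝ (Fin d)) (Q : ℕ → UnitAddTorus (Fin (d + 1)) → ℝ)
    (c : ℕ → ℝ) (s : ℕ) (y : UnitAddTorus (Fin (d + 1))) : EuclideanSpace ℝ (Fin d) :=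
  (∑ a ∈ Finset.range (N + 1), ∑ b ∈ Finset.range (N + 1),
      ((if a + b + 1 = s then ∑ l : Fin d, (P a y) l • sDeriv l (P b) y else 0) +
        (if a + b = s then ∑ l : Fin d, (P a y) l • fDeriv j G l (P b) y else 0)))
  - (∑ a ∈ Finset.range (N + 1),
      ((if a + 3 = s then ∑ i : Fin d, sDeriv i (sDeriv i (P a)) y else 0) +
        (if a + 2 = s then ∑ i : Fin d, (sDeriv i (fDeriv j G i (P a)) y + fDeriv j G i (sDeriv i (P a)) y)
          else 0) +
        (if a + 1 = s then ∑ i : Fin d, fDeriv j G i (fDeriv j G i (P a)) y else 0)))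
  + (∑ a ∈ Finset.range (N + 1),
      WithLp.toLp 2 (fun i : Fin d =>
        (if a + 1 = s then sDeriv i (Q a) y else 0) + (if a = s then fDeriv j G i (Q a) y else 0)))
  - (∑ a ∈ Finset.range (N + 1), ∑ b ∈ Finset.range (N + 1),
      ((if a + b + 1 = s then c a • sDeriv ic (P b) y else 0) +
        (if a + b = s then c a • fDeriv j G ic (P b) y else 0)))
  - (if s = 1 then f (slow y) else 0)

/-! ## §6 Elementary identities -/

/-- `D^ε_i Φ = ∂_{xᵢ}Φ + ε⁻¹ • kᵢ∂_θΦ`, i.e. `tsDeriv = sDeriv + ε⁻¹ • fDeriv` pointwise. [folklore] -/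
theorem tsDeriv_eq_sDeriv_add_smul_fDeriv (ε : ℝ) (j : Fin d → ℤ) (G : UnitAddTorus (Fin d) → ℝ) (i : Fin d)
    (Φ : UnitAddTorus (Fin (d + 1)) → F) (y : UnitAddTorus (Fin (d + 1))) :
    tsDeriv ε j G i Φ y = sDeriv i Φ y + ε⁻¹ • fDeriv j G i Φ y := by
  simp only [tsDeriv, sDeriv, fDeriv, mul_smul]

/-- The dissipation density is `∑ᵢ ‖kᵢ ∂_θ Φ‖²`. [folklore] -/
theorem dissDensity_eq_sum_norm_fDeriv_sq (j : Fin d → ℤ) (G : UnitAddTorus (Fin d) → ℝ)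
    (Φ : UnitAddTorus (Fin (d + 1)) → F) (y : UnitAddTorus (Fin (d + 1))) :
    dissDensity j G Φ y = ∑ i : Fin d, ‖fDeriv j G i Φ y‖ ^ 2 := by
  simp [dissDensity, fDeriv, norm_smul, mul_pow, sq_abs]

/-- The dissipation density is nonnegative. [folklore] -/
theorem dissDensity_nonneg (j : Fin d → ℤ) (G : UnitAddTorus (Fin d) → ℝ) (Φ : UnitAddTorus (Fin (d + 1)) → F)
    (y : UnitAddTorus (Fin (d + 1))) : 0 ≤ dissDensity j G Φ y :=
  Finset.sum_nonneg fun _ _ => mul_nonneg (sq_nonneg _) (sq_nonneg _)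

/-- Torus partial derivatives of a constant function vanish. [folklore] -/
theorem partialDeriv_constFun {ι : Type*} [Fintype ι] [DecidableEq ι] (m : ι) (v : F) :
    Torus.partialDeriv m (fun _ : UnitAddTorus ι => v) = fun _ => 0 := by
  funext y
  simp [Torus.partialDeriv, Torus.lineDeriv]

/-- Two-scale derivatives of a constant profile vanish. [folklore] -/
theorem tsDeriv_constFun (ε : ℝ) (j : Fin d → ℤ) (G : UnitAddTorus (Fin d) → ℝ) (i : Fin d) (v : F) :
    tsDeriv ε j G i (fun _ : UnitAddTorus (Fin (d + 1)) => v) = fun _ => 0 := by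
  funext y
  simp [tsDeriv, partialDeriv_constFun]

/-- Functions of the slow point only are smooth profiles. [folklore] -/
theorem isSmooth_comp_slow {g : UnitAddTorus (Fin d) → F} (hg : IsSmooth g) :
    IsSmooth (fun y : UnitAddTorus (Fin (d + 1)) => g (slow y)) := by
  have h : Torus.lift (fun y : UnitAddTorus (Fin (d + 1)) => g (slow y)) =
      Torus.lift g ∘ fun z : EuclideanSpace ℝ (Fin (d + 1)) =>
        (WithLp.toLp 2 fun i : Fin d => z (Fin.castSucc i) : EuclideanSpace ℝ (Fin d)) := by
    funext z
    rfl
  unfold IsSmooth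
  rw [h]
  refine hg.comp ?_
  rw [contDiff_piLp]
  intro i
  exact (EuclideanSpace.proj (Fin.castSucc i) : EuclideanSpace ℝ (Fin (d + 1)) →L[ℝ] ℝ).contDiff

/-- The two-scale derivative `D^ε_i Φ` of a smooth profile is a smooth profile (for smooth `G`). [folklore] -/
theorem isSmooth_tsDeriv (ε : ℝ) (j : Fin d → ℤ) {G : UnitAddTorus (Fin d) → ℝ}
    {Φ : UnitAddTorus (Fin (d + 1)) → F} (hG : IsSmooth G) (hΦ : IsSmooth Φ) (i : Fin d) :
    IsSmooth (tsDeriv ε j G i Φ) := by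
  have h1 : IsSmooth (fun y : UnitAddTorus (Fin (d + 1)) => ε⁻¹ * phaseGrad j G i (slow y)) :=
    (isSmooth_const _).smul' (isSmooth_comp_slow (isSmooth_phaseGrad j hG i))
  exact (hΦ.partialDeriv i.castSucc).add (h1.smul' (hΦ.partialDeriv (Fin.last d)))

/-! ## §7 Evaluation on the fast phase: the real lift and the first-order chain rule -/

/-- `m • ↑r = ↑(m r)` in `ℝ/ℤ` for an integer `m` and a real `r`. [folklore] -/
theorem zsmul_coe_unitAddCircle (m : ℤ) (r : ℝ) :
    m • ((r : ℝ) : UnitAddCircle) = (((m : ℝ) * r : ℝ) : UnitAddCircle) := by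
  rw [← AddCircle.coe_zsmul, zsmul_eq_mul]

/-- The fast phase read on the covering space: `θ_n (proj y) = ↑((n+1)(j·y + G(proj y)))`. [folklore] -/
theorem fastPhase_proj (j : Fin d → ℤ) (G : UnitAddTorus (Fin d) → ℝ) (n : ℕ) (y : EuclideanSpace ℝ (Fin d)) :
    fastPhase j G n (Torus.proj y) =
      ((((n : ℝ) + 1) * (∑ i : Fin d, (j i : ℝ) * y i + Torus.lift G y) : ℝ) : UnitAddCircle) := by
  unfold fastPhase
  simp only [Torus.proj_apply, Torus.lift_apply, zsmul_coe_unitAddCircle]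
  rw [← QuotientAddGroup.mk_sum, ← QuotientAddGroup.mk_add]
  congr 1
  push_cast
  rw [mul_add, Finset.mul_sum]
  simp only [mul_assoc]

/-- The REAL LIFT `𝓔_n : ℝ^d → ℝ^{d+1}`, `y ↦ (y, (n+1)(j·y + G(proj y)))`, of the evaluation map, written in the
standard basis. [folklore] -/
def phaseLift (j : Fin d → ℤ) (G : UnitAddTorus (Fin d) → ℝ) (n : ℕ) (y : EuclideanSpace ℝ (Fin d)) :
    EuclideanSpace ℝ (Fin (d + 1)) :=
  (∑ i : Fin d, y i • EuclideanSpace.single (Fin.castSucc i) (1 : ℝ)) +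
    (((n : ℝ) + 1) * (∑ i : Fin d, (j i : ℝ) * y i + Torus.lift G y)) • EuclideanSpace.single (Fin.last d) (1 : ℝ)

/-- `proj ∘ 𝓔_n = e_n ∘ proj`: the real lift covers the evaluation map. [folklore] -/
theorem proj_phaseLift (j : Fin d → ℤ) (G : UnitAddTorus (Fin d) → ℝ) (n : ℕ) (y : EuclideanSpace ℝ (Fin d)) :
    Torus.proj (phaseLift j G n y) = phaseMap j G n (Torus.proj y) := by
  have hne : ∀ i : Fin d, Fin.last d ≠ Fin.castSucc i := fun i => (Fin.castSucc_ne_last i).symm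
  funext k
  rw [Torus.proj_apply]
  induction k using Fin.lastCases with
  | last =>
      simp only [phaseLift, phaseMap, Fin.snoc_last, fastPhase_proj, PiLp.add_apply, PiLp.smul_apply,
        WithLp.ofLp_sum, Finset.sum_apply, PiLp.single_apply, hne, if_false, smul_eq_mul, mul_zero,
        Finset.sum_const_zero, if_true, mul_one, zero_add]
  | cast i =>
      simp only [phaseLift, phaseMap, Fin.snoc_castSucc, Torus.proj_apply, PiLp.add_apply, PiLp.smul_apply,
        WithLp.ofLp_sum, Finset.sum_apply, PiLp.single_apply, Fin.castSucc_inj, Fin.castSucc_ne_last,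
        if_false, smul_eq_mul, mul_zero, add_zero, mul_ite, mul_one, Finset.sum_ite_eq, Finset.mem_univ,
        if_true]

/-- The real lift `𝓔_n` is smooth when `G` is. [folklore] -/
theorem contDiff_phaseLift (j : Fin d → ℤ) {G : UnitAddTorus (Fin d) → ℝ} (hG : IsSmooth G) (n : ℕ) :
    ContDiff ℝ ∞ (phaseLift j G n) := by
  have hc : ∀ i : Fin d, ContDiff ℝ ∞ (fun y : EuclideanSpace ℝ (Fin d) => y i) := fun i =>
    (EuclideanSpace.proj i : EuclideanSpace ℝ (Fin d) →L[ℝ] ℝ).contDiff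
  exact (ContDiff.sum fun i _ => (hc i).smul contDiff_const).add
    ((contDiff_const.mul ((ContDiff.sum fun i _ => contDiff_const.mul (hc i)).add hG)).smul contDiff_const)

/-- The derivative of the real lift: `D𝓔_n(y) eᵢ = e_{i} + (n+1) kᵢ(proj y) e_θ`, `k = ∇G + j`. [folklore] -/
theorem hasFDerivAt_phaseLift (j : Fin d → ℤ) {G : UnitAddTorus (Fin d) → ℝ} (hG : IsSmooth G) (n : ℕ)
    (y : EuclideanSpace ℝ (Fin d)) :
    ∃ L : EuclideanSpace ℝ (Fin d) →L[ℝ] EuclideanSpace ℝ (Fin (d + 1)),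
      HasFDerivAt (phaseLift j G n) L y ∧
        ∀ i : Fin d, L (EuclideanSpace.single i 1) =
          EuclideanSpace.single (Fin.castSucc i) 1 +
            (((n : ℝ) + 1) * phaseGrad j G i (Torus.proj y)) • EuclideanSpace.single (Fin.last d) 1 := by
  have hG1 : IsContDiff 1 G := hG.isContDiff (by simp)
  have hpr : ∀ i : Fin d, HasFDerivAt (fun z : EuclideanSpace ℝ (Fin d) => z i)
      (EuclideanSpace.proj i : EuclideanSpace ℝ (Fin d) →L[ℝ] ℝ) y := fun i =>
    (EuclideanSpace.proj i : EuclideanSpace ℝ (Fin d) →L[ℝ] ℝ).hasFDerivAt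
  have hlift : HasFDerivAt (Torus.lift G) (Torus.fderiv G (Torus.proj y)) y := by
    rw [← Torus.fderiv_lift]
    exact ((hG.differentiable (by simp)).differentiableAt).hasFDerivAt
  refine ⟨_, (HasFDerivAt.fun_sum (u := Finset.univ) fun i _ =>
      (hpr i).smul_const (EuclideanSpace.single (Fin.castSucc i) (1 : ℝ))).add
    ((((HasFDerivAt.fun_sum (u := Finset.univ) fun i _ => (hpr i).const_mul (j i : ℝ)).add hlift).const_mul
      ((n : ℝ) + 1)).smul_const (EuclideanSpace.single (Fin.last d) (1 : ℝ))), fun i => ?_⟩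
  simp only [_root_.add_apply, sum_apply, ContinuousLinearMap.smulRight_apply,
    _root_.smul_apply, PiLp.proj_apply, PiLp.single_apply, ite_smul, one_smul, zero_smul,
    Finset.sum_ite_eq', Finset.mem_univ, if_true, smul_eq_mul, mul_ite, mul_one, mul_zero]
  rw [← partialDeriv_eq_fderiv_apply hG1, phaseGrad, add_comm (Torus.partialDeriv i G (Torus.proj y))]

/-- The lift of an evaluated profile factors through the real lift: `lift (Φ ∘ e_n) = lift Φ ∘ 𝓔_n`. [folklore] -/
theorem lift_comp_phaseMap {E : Type*} (Φ : UnitAddTorus (Fin (d + 1)) → E) (j : Fin d → ℤ)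
    (G : UnitAddTorus (Fin d) → ℝ) (n : ℕ) :
    Torus.lift (fun x => Φ (phaseMap j G n x)) = Torus.lift Φ ∘ phaseLift j G n := by
  funext y
  rw [Torus.lift_apply, Function.comp_apply, Torus.lift_apply, proj_phaseLift]

/-- **Evaluated profiles are smooth**: `x ↦ Φ (e_n x)` is smooth on `T^d` for a smooth profile `Φ` and a smooth
`G`. [folklore] -/
theorem isSmooth_comp_phaseMap (j : Fin d → ℤ) {G : UnitAddTorus (Fin d) → ℝ}
    {Φ : UnitAddTorus (Fin (d + 1)) → F} (hG : IsSmooth G) (hΦ : IsSmooth Φ) (n : ℕ) :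
    IsSmooth (fun x => Φ (phaseMap j G n x)) := by
  unfold IsSmooth
  rw [lift_comp_phaseMap]
  exact hΦ.comp (contDiff_phaseLift j hG n)

/-- **First-order chain rule through the evaluation map**: `∂ᵢ (Φ ∘ e_n) (x) = (D^ε_i Φ)(e_n x)` with
`D^ε_i = ∂ᵢ + ε⁻¹ kᵢ ∂_θ = tsDeriv`, `ε = ε_n`, `ε⁻¹ = n + 1`: derivatives of the substituted function are the
two-scale derivatives of the profile ("toute solution de (S) fournit une solution de (1.1)").
[cite: CheverryGuesMetivier2003, §2.3 p. 697] -/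
theorem partialDeriv_comp_phaseMap {j : Fin d → ℤ} {G : UnitAddTorus (Fin d) → ℝ}
    {Φ : UnitAddTorus (Fin (d + 1)) → F} (hG : IsSmooth G) (hΦ : IsSmooth Φ) (n : ℕ) (i : Fin d)
    (x : UnitAddTorus (Fin d)) :
    Torus.partialDeriv i (fun x => Φ (phaseMap j G n x)) x = tsDeriv (epsN n) j G i Φ (phaseMap j G n x) := by
  obtain ⟨y, rfl⟩ := Torus.proj_surjective x
  have hΦ1 : IsContDiff 1 Φ := hΦ.isContDiff (by simp)
  have hW : IsSmooth (fun x => Φ (phaseMap j G n x)) := isSmooth_comp_phaseMap j hG hΦ n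
  obtain ⟨L, hL, hLi⟩ := hasFDerivAt_phaseLift j hG n y
  have hcomp : HasFDerivAt (Torus.lift (fun x => Φ (phaseMap j G n x)))
      ((Torus.fderiv Φ (phaseMap j G n (Torus.proj y))).comp L) y := by
    rw [lift_comp_phaseMap]
    refine HasFDerivAt.comp y ?_ hL
    refine (((hΦ.differentiable (by simp)).differentiableAt).hasFDerivAt).congr_fderiv ?_
    rw [Torus.fderiv_lift, proj_phaseLift]
  rw [partialDeriv_eq_fderiv_apply (hW.isContDiff (by simp)), ← Torus.fderiv_lift, hcomp.fderiv,
    ContinuousLinearMap.comp_apply, hLi, map_add, map_smul, tsDeriv, partialDeriv_eq_fderiv_apply hΦ1,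
    partialDeriv_eq_fderiv_apply hΦ1, slow_phaseMap, inv_epsN]

end TwoScale

end Literature.Analysis.GeometricOptics

end
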